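import Summits.HodgeConjecture.HodgeConjecture.Theorems.GenericDivisibilityHodgeClassesGenericallyDivisibleStubOnePrimePrinciple
import Summits.HodgeConjecture.HodgeConjecture.Theorems.GenericDivisibilityHodgeClassesGenericallyDivisibleStubMultipleSupportedComplexSupported
import HarnessLib

/-!
# Route GenericDivisibility — crux `HodgeClassesGenericallyDivisible` (stmt-HodgeConjecture-18466), line `Sketch`: stub `stub_onePrimeSupported`

Registered stub of the lead's reshaped skeleton `Cruxes/HodgeClassesGenericallyDivisible/Lines/Sketch.lean`
(2026-08-17T07:17Z): the ONE-PRIME PRINCIPLE in its supported form — on a smooth projective `X/ℂ`,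
an integral class `z ∈ H^q(X(ℂ); ℤ)` that is, for every `k`, congruent modulo `ℓᵏ · H` to a class of
integral coniveau `≥ 1` (`ℓ` one prime) has complexification in
`N¹ H^q(X(ℂ); ℂ) = supportedClasses X q 1` (rational coniveau one WITHOUT C2 for that `z`).
It is the composite of the two landed stubs `stub_onePrimePrinciple` (some `N • z`, `N ≥ 1` prime to
`ℓ`, has integral coniveau `≥ 1`; Krull) and `stub_multipleSupportedComplexSupported` (then `z ⊗ 1`
is supported; `N` is a unit of `ℂ`).
-/

noncomputable section

-- every declaration of this problem lives in `Summit.HodgeConjecture.HodgeConjecture.…` (summit = sub-problem)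
set_option linter.dupNamespace false

open CategoryTheory AlgebraicGeometry
open Literature.AlgebraicGeometry.Motives Literature.AlgebraicGeometry.HodgeTheory
  Literature.AlgebraicTopology.SingularHomology

namespace Summit.HodgeConjecture.HodgeConjecture.Theorems

/-- **Stub `stub_onePrimeSupported` of line `Sketch` (crux C1): phantom-free divisibility at all
powers of ONE prime forces complex coniveau `≥ 1`.** Composite of `stub_onePrimePrinciple` and
`stub_multipleSupportedComplexSupported`. [cite: HatcherAT2002, Cor. A.9] [cite: GrothendieckTopology1969, §1] -/
theorem stub_onePrimeSupported : ∀ ⦃n : ℕ⦄ ⦃X : SchemeOver ℂ⦄, IsSmoothProjective n X →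
    ∀ (q : ℕ) (z : singularCohomology ℤ ℤ (ComplexPoints X) q) (ℓ : ℕ), ℓ.Prime →
      (∀ k : ℕ, ∃ y ∈ coniveauFiltration ℤ X q 1,
        ∃ w : singularCohomology ℤ ℤ (ComplexPoints X) q, z = y + (ℓ ^ k) • w) →
      singularCohomology.ringChange (Int.castRingHom ℂ) (ComplexPoints X) q z ∈
        supportedClasses X q 1 := by
  intro n X hX q z ℓ hℓ hz
  obtain ⟨N, hN, -, hmem⟩ := stub_onePrimePrinciple hX q z ℓ hℓ hz
  exact stub_multipleSupportedComplexSupported q z N hN hmem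

end Summit.HodgeConjecture.HodgeConjecture.Theorems

end
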